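import Summits.Ventures.PercRepro.SixFourIdentities
import Summits.Ventures.PercRepro.PlaneCore

/-!
# PercRepro — C-025 at `(6,4)`, Proposition 21.9, part A: the cell and its subset counts (p3, gen 8)

mine-2's `MINE2-RLS.md` §21.9, PROPOSITION 21.9: «Let `G` be a solid on `g = 10` points in which every plane has
`≤ 5` points and every line `≤ 4` points.  Then `(J₃^∞)` holds, with `J₃ ≥ 153.6`.»  This part sets up the cell
(`Cell10`: `G ⊆ E` of rank `4` with `10` points whose plane traces have `≤ 5` and whose line traces `≤ 4` points,
in a simple matroid) and proves the subset counts that feed the identity `J_three_eq` of `SixFourIdentities.lean`: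

* size from rank: a rank-`≤ 2` subset of `G` has `≤ 4` points, a rank-`≤ 3` subset `≤ 5` points, and every subset
  with `≥ 6` points has rank `4` (`card_le_four_of_eRk_le_two`, `card_le_five_of_eRk_le_three`,
  `eRk_eq_four_of_six_le`);
* with `d₄` = the dependent `4`-subsets and `e₅` = the rank-`3` `5`-subsets: `I₄ + d₄ = C(10,4) = 210`
  (`I4_add_d4`) and `N₄ + d₄ + e₅ = 2¹⁰ − (1 + 10 + 45 + 120) = 848` (`N4_add_d4_add_e5`);
* `DF₃ ≥ 1 + 10 + 45 = 56` (`df_three_ge`: the complements of the `≤ 2`-subsets are demand-free).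

Part B (`SixFourT3.lean`) adds the plane counts (`pp + 2·lpp ≤ 6a₄ + 30a₅`, `e₅ ≤ a₅`, `3a₄ + 6a₅ ≤ 120`) and the
final inequality.
-/

namespace PercRepro.SixFour

open Finset ThmH

variable {α : Type*} [DecidableEq α] {M : Matroid α} [M.Finite] {G : Finset α}

/-! ## The cell of Proposition 21.9 -/

/-- The cell «`g = 10`, planes `≤ 5`, lines `≤ 4`» of mine-2 §21.9: `G ⊆ E` has rank `4` and `10` points, every
plane of `M` meets `G` in at most `5` points and every line of `M` in at most `4`. -/
structure Cell10 (M : Matroid α) [M.Finite] (G : Finset α) : Prop where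
  /-- `G` lies in the ground set. -/
  subset : G ⊆ gr M
  /-- `G` has rank `4`. -/
  rank : M.eRk (G : Set α) = 4
  /-- `G` has `10` points. -/
  card : G.card = 10
  /-- Every plane trace has at most `5` points. -/
  plane_le : ∀ P ∈ planes M, (P ∩ G).card ≤ 5
  /-- Every line trace has at most `4` points. -/
  line_le : ∀ L ∈ lines M, (L ∩ G).card ≤ 4

omit [DecidableEq α] in
/-- A rank bounded by `n` and at least `n` is `n` (in `ℕ∞`, for a finset). -/
theorem eRk_eq_of_le_of_not_le {B : Finset α} {n : ℕ} (hle : M.eRk (B : Set α) ≤ (n + 1 : ℕ))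
    (hnot : ¬ M.eRk (B : Set α) ≤ (n : ℕ)) : M.eRk (B : Set α) = (n + 1 : ℕ) := by
  obtain ⟨k, hk, -⟩ := eRk_eq_nat M B
  rw [hk] at hle hnot ⊢
  have h1 : k ≤ n + 1 := by exact_mod_cast hle
  have h2 : ¬ k ≤ n := fun h => hnot (by exact_mod_cast h)
  congr 1
  omega

/-- The rank of a subset of `G` is at most the rank of `G`. -/
theorem eRk_le_of_subset_cell (h : Cell10 M G) {B : Finset α} (hB : B ⊆ G) : M.eRk (B : Set α) ≤ 4 := by
  rw [← h.rank]
  exact M.eRk_mono (Finset.coe_subset.2 hB)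

/-- A subset of `G` of rank at most `2` has at most `4` points (it lies on a line). -/
theorem card_le_four_of_eRk_le_two (hs : Simple M) (h : Cell10 M G) {B : Finset α} (hB : B ⊆ G)
    (hr : M.eRk (B : Set α) ≤ 2) : B.card ≤ 4 := by
  by_contra hlt
  obtain ⟨a, ha, b, hb, hab⟩ := Finset.one_lt_card.1 (by omega : 1 < B.card)
  have h2r := two_le_eRk_of_two_mem hs (hB.trans h.subset) ha hb hab
  have hr2 : M.eRk (B : Set α) = 2 := le_antisymm hr h2r
  obtain ⟨hL, hBL⟩ := clF_mem_lines (hB.trans h.subset) hr2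
  have hsub : B ⊆ clF M B ∩ G := Finset.subset_inter hBL hB
  have := (Finset.card_le_card hsub).trans (h.line_le _ hL)
  omega

/-- A subset of `G` of rank at most `3` has at most `5` points (it lies in a plane). -/
theorem card_le_five_of_eRk_le_three (hs : Simple M) (h : Cell10 M G) {B : Finset α} (hB : B ⊆ G)
    (hr : M.eRk (B : Set α) ≤ 3) : B.card ≤ 5 := by
  by_cases h2 : M.eRk (B : Set α) ≤ 2
  · exact (card_le_four_of_eRk_le_two hs h hB h2).trans (by norm_num)
  · have hr3 : M.eRk (B : Set α) = 3 := eRk_eq_of_le_of_not_le (n := 2) hr h2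
    obtain ⟨hP, hBP⟩ := clF_mem_planes (hB.trans h.subset) hr3
    have hsub : B ⊆ clF M B ∩ G := Finset.subset_inter hBP hB
    exact (Finset.card_le_card hsub).trans (h.plane_le _ hP)

/-- A subset of `G` with at least `6` points has rank `4`. -/
theorem eRk_eq_four_of_six_le (hs : Simple M) (h : Cell10 M G) {B : Finset α} (hB : B ⊆ G)
    (h6 : 6 ≤ B.card) : M.eRk (B : Set α) = 4 := by
  have hle := eRk_le_of_subset_cell h hB
  have h3 : ¬ M.eRk (B : Set α) ≤ 3 := fun h3 => by
    have := card_le_five_of_eRk_le_three hs h hB h3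
    omega
  exact eRk_eq_of_le_of_not_le (n := 3) hle h3

/-- For a subset of `G`: not rank `4` means rank at most `3`. -/
theorem eRk_le_three_iff_ne_four (h : Cell10 M G) {B : Finset α} (hB : B ⊆ G) :
    M.eRk (B : Set α) ≤ 3 ↔ ¬ M.eRk (B : Set α) = 4 := by
  have hle := eRk_le_of_subset_cell h hB
  constructor
  · intro h3 h4
    rw [h4] at h3
    exact absurd h3 (by decide)
  · intro h4
    by_contra h3
    exact h4 (eRk_eq_of_le_of_not_le (n := 3) hle h3)

/-! ## The subset counts `d₄`, `e₅` and the identities `I₄ + d₄ = 210`, `N₄ + d₄ + e₅ = 848` -/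

/-- `d₄(G)`: the dependent `4`-subsets of `G` (rank `≤ 3`). -/
noncomputable def d4 (M : Matroid α) [M.Finite] (G : Finset α) : ℕ :=
  ((G.powersetCard 4).filter (fun B : Finset α => M.eRk (B : Set α) ≤ 3)).card

/-- `e₅(G)`: the `5`-subsets of `G` of rank `≤ 3` (in the cell, exactly the rank-`3` ones: the `5`-point plane
traces). -/
noncomputable def e5 (M : Matroid α) [M.Finite] (G : Finset α) : ℕ :=
  ((G.powersetCard 5).filter (fun B : Finset α => M.eRk (B : Set α) ≤ 3)).card

omit [DecidableEq α] in
/-- The `4`-subsets of rank `4` are the `4`-point members of `R₄(G)`. -/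
theorem filter_R4_card_four (G : Finset α) :
    (R4 M G).filter (fun B : Finset α => B.card = 4) =
      (G.powersetCard 4).filter (fun B : Finset α => M.eRk (B : Set α) = 4) := by
  rw [Finset.powersetCard_eq_filter]
  unfold R4
  rw [Finset.filter_filter, Finset.filter_filter]
  exact Finset.filter_congr (fun B _ => and_comm)

/-- `I₄ + d₄ = C(10, 4) = 210`. -/
theorem I4_add_d4 (h : Cell10 M G) : I4 M G + d4 M G = 210 := by
  unfold I4 d4
  rw [filter_R4_card_four]
  have hcongr : (G.powersetCard 4).filter (fun B : Finset α => M.eRk (B : Set α) ≤ 3) =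
      (G.powersetCard 4).filter (fun B : Finset α => ¬ M.eRk (B : Set α) = 4) :=
    Finset.filter_congr (fun B hB => eRk_le_three_iff_ne_four h (Finset.mem_powersetCard.1 hB).1)
  rw [hcongr, Finset.card_filter_add_card_filter_not, Finset.card_powersetCard, h.card]
  rfl

/-- The rank-`≤ 3` subsets with `i ≤ 3` points are all the `i`-subsets. -/
theorem card_filter_le_three_of_le (h : Cell10 M G) {i : ℕ} (hi : i ≤ 3) :
    ((G.powersetCard i).filter (fun B : Finset α => M.eRk (B : Set α) ≤ 3)).card = Nat.choose 10 i := by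
  rw [Finset.filter_true_of_mem, Finset.card_powersetCard, h.card]
  intro B hB
  obtain ⟨-, hc⟩ := Finset.mem_powersetCard.1 hB
  have := M.eRk_le_encard (B : Set α)
  rw [Set.encard_coe_eq_coe_finsetCard, hc] at this
  exact this.trans (by exact_mod_cast hi)

/-- No rank-`≤ 3` subset has `6 ≤ i` points. -/
theorem card_filter_le_three_of_six_le (hs : Simple M) (h : Cell10 M G) {i : ℕ} (hi : 6 ≤ i) :
    ((G.powersetCard i).filter (fun B : Finset α => M.eRk (B : Set α) ≤ 3)).card = 0 := by
  rw [Finset.card_eq_zero, Finset.filter_false_of_mem]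
  intro B hB h3
  obtain ⟨hBG, hc⟩ := Finset.mem_powersetCard.1 hB
  have := card_le_five_of_eRk_le_three hs h hBG h3
  omega

/-- `N₄ + d₄ + e₅ = 2¹⁰ − 176 = 848` (the subsets of `G` of rank `≤ 3` are the `176` sets with `≤ 3` points,
the `d₄` dependent `4`-sets and the `e₅` rank-`3` `5`-sets). -/
theorem N4_add_d4_add_e5 (hs : Simple M) (h : Cell10 M G) : N4 M G + d4 M G + e5 M G = 848 := by
  have hcongr : G.powerset.filter (fun B : Finset α => ¬ M.eRk (B : Set α) = 4) =
      G.powerset.filter (fun B : Finset α => M.eRk (B : Set α) ≤ 3) :=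
    Finset.filter_congr (fun B hB => (eRk_le_three_iff_ne_four h (Finset.mem_powerset.1 hB)).symm)
  have htot := Finset.card_filter_add_card_filter_not (s := G.powerset)
    (fun B : Finset α => M.eRk (B : Set α) = 4)
  rw [hcongr, Finset.card_powerset, h.card] at htot
  have hdec : (G.powerset.filter (fun B : Finset α => M.eRk (B : Set α) ≤ 3)).card = 176 + d4 M G + e5 M G := by
    rw [Finset.powerset_card_disjiUnion, Finset.filter_disjiUnion, Finset.card_disjiUnion, h.card]
    simp only [Finset.sum_range_succ, Finset.sum_range_zero]
    rw [card_filter_le_three_of_le h (by norm_num : 0 ≤ 3), card_filter_le_three_of_le h (by norm_num : 1 ≤ 3),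
      card_filter_le_three_of_le h (by norm_num : 2 ≤ 3), card_filter_le_three_of_le h (by norm_num : 3 ≤ 3),
      card_filter_le_three_of_six_le hs h (by norm_num : 6 ≤ 6),
      card_filter_le_three_of_six_le hs h (by norm_num : 6 ≤ 7),
      card_filter_le_three_of_six_le hs h (by norm_num : 6 ≤ 8),
      card_filter_le_three_of_six_le hs h (by norm_num : 6 ≤ 9),
      card_filter_le_three_of_six_le hs h (by norm_num : 6 ≤ 10)]
    unfold d4 e5
    simp only [Nat.choose_zero_right, Nat.choose_one_right]
    rw [show Nat.choose 10 2 = 45 from rfl, show Nat.choose 10 3 = 120 from rfl]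
    ring
  unfold N4 R4
  omega

/-! ## `DF₃ ≥ 56` -/

/-- The complement of a set with at most `2` points is demand-free at `t = 3`: it has rank `4` and its
complement has rank `≤ 2`. -/
theorem sdiff_mem_DF_filter (hs : Simple M) (h : Cell10 M G) {Z : Finset α} (hZ : Z ⊆ G) (hc : Z.card ≤ 2) :
    G \ Z ∈ (R4 M G).filter (fun B : Finset α => M.eRk ((G \ B : Finset α) : Set α) + 1 ≤ ((3 : ℕ) : ℕ∞)) := by
  rw [Finset.mem_filter, mem_R4]
  have hcard : (G \ Z).card = 10 - Z.card := by rw [Finset.card_sdiff_of_subset hZ, h.card]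
  refine ⟨⟨Finset.sdiff_subset, eRk_eq_four_of_six_le hs h Finset.sdiff_subset (by omega)⟩, ?_⟩
  rw [Finset.sdiff_sdiff_eq_self hZ]
  have := M.eRk_le_encard (Z : Set α)
  rw [Set.encard_coe_eq_coe_finsetCard] at this
  have h2 : (Z.card : ℕ∞) ≤ 2 := by exact_mod_cast hc
  calc M.eRk (Z : Set α) + 1 ≤ 2 + 1 := by gcongr; exact this.trans h2
    _ = ((3 : ℕ) : ℕ∞) := by norm_num

/-- The subsets of `G` with at most `2` points number `1 + 10 + 45 = 56`. -/
theorem card_filter_card_le_two (h : Cell10 M G) :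
    (G.powerset.filter (fun Z : Finset α => Z.card ≤ 2)).card = 56 := by
  rw [Finset.powerset_card_disjiUnion, Finset.filter_disjiUnion, Finset.card_disjiUnion, h.card]
  simp only [Finset.sum_range_succ, Finset.sum_range_zero]
  have hall : ∀ i ≤ 2, ((G.powersetCard i).filter (fun Z : Finset α => Z.card ≤ 2)).card = Nat.choose 10 i := by
    intro i hi
    rw [Finset.filter_true_of_mem, Finset.card_powersetCard, h.card]
    intro Z hZ
    rw [(Finset.mem_powersetCard.1 hZ).2]
    exact hi
  have hnone : ∀ i, 3 ≤ i → ((G.powersetCard i).filter (fun Z : Finset α => Z.card ≤ 2)).card = 0 := by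
    intro i hi
    rw [Finset.card_eq_zero, Finset.filter_false_of_mem]
    intro Z hZ
    rw [(Finset.mem_powersetCard.1 hZ).2]
    omega
  rw [hall 0 (by norm_num), hall 1 (by norm_num), hall 2 (by norm_num), hnone 3 (by norm_num),
    hnone 4 (by norm_num), hnone 5 (by norm_num), hnone 6 (by norm_num), hnone 7 (by norm_num),
    hnone 8 (by norm_num), hnone 9 (by norm_num), hnone 10 (by norm_num)]
  rfl

/-- `56 ≤ DF₃(G)`: `Z ↦ G ∖ Z` injects the `≤ 2`-subsets into the demand-free sets. -/
theorem df_three_ge (hs : Simple M) (h : Cell10 M G) : 56 ≤ DF M G 3 := by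
  unfold DF
  rw [← card_filter_card_le_two h]
  refine Finset.card_le_card_of_injOn (fun Z => G \ Z) ?_ ?_
  · intro Z hZ
    rw [Finset.coe_filter] at hZ
    obtain ⟨hZG, hc⟩ := hZ
    rw [Finset.mem_powerset] at hZG
    exact sdiff_mem_DF_filter hs h hZG hc
  · intro Z₁ hZ₁ Z₂ hZ₂ heq
    rw [Finset.coe_filter] at hZ₁ hZ₂
    have h1 : Z₁ ⊆ G := Finset.mem_powerset.1 hZ₁.1
    have h2 : Z₂ ⊆ G := Finset.mem_powerset.1 hZ₂.1
    have heq' : G \ Z₁ = G \ Z₂ := heq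
    have : G \ (G \ Z₁) = G \ (G \ Z₂) := by rw [heq']
    rwa [Finset.sdiff_sdiff_eq_self h1, Finset.sdiff_sdiff_eq_self h2] at this

end PercRepro.SixFour
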